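import Summits.BirchSwinnertonDyer.Rank1Residual.Additive.SubGordTwoReducible
import Summits.BirchSwinnertonDyer.Rank1Residual.Additive.TypeGIntegralJ
import HarnessLib

/-!
# X3♯(G-ord) / X4♯(G-ord), defect 2: (G)-ORDINARY ⟹ the twist `E^{(p*)}` is good ORDINARY — the twist datum discharged

HONEST FRAMING (cell `b2b-bsdres`, run/shared/lean/b2b/bsd-rank1-residual/, verbatim in every
file): the goal of the cell is to DELETE the COMBINATION-SHAPED residual classes of the
Birch–Swinnerton-Dyer formula for ALL analytic-rank `≤ 1` elliptic curves over `ℚ` — "full BSD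
formula for every rank `≤ 1` curve in class `C`" assembled STRICTLY from published theorems — so
that the rank-`≤ 1` remainder becomes exactly the CONSTRUCTION-SHAPED classes, which are TYPED
(missing-input `Prop`s), NOT attempted. This is not "finishing BSD". Sub-cell `additive-p2`
(CLASS-OWNERS row "X3/X4 additive — pot. good ordinary / X3♯(G-ord)"), generation 4: research
route; no claim beyond the stated classes; theorems only, no definition, no new named fact;
X3♯(G-ord)/X4♯(G-ord) stay CONSTRUCTION-SHAPED.

WHAT THIS FILE DOES. The descent theorems of `GordDescent.lean` / `GordDescentExact.lean` /
`GordDescentOneSided.lean` (gens 2–3) carry the good-ORDINARY twist `Wd ≅ E^{(p*)}` as a DATUM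
(`hord : GoodOrd Wd p`). Gen 0 proved the direction datum ⟹ theory
(`typeGOrd_of_goodOrd_quadraticTwist`: `GoodOrd Wd p → TypeGOrd W p`). Here the CONVERSE is
proved, so that on the defect-2 cell the theory class `TypeGOrd` (Delbourgo's (G) with ordinary
reduction, `PotGoodOrdinary.lean`) and the twist datum are EQUIVALENT in the kernel:

* `hasUnitRootAt_baseChange_iff_of_hasGoodReductionAt` — for an elliptic curve `V/K` over a number
  field with good reduction at `v ∋ p`, a finite extension `M/K` and `w ∣ v`:
  **`V_M` has the unit-root (ordinary) condition at `w` iff `V` has it at `v`** — any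
  ramification. (`a_w = D_f(a_v, q_v) ≡ a_v^f (mod p)`, Silverman *AEC* V.2.3.1 via the tree's
  `localPolynomialAt_baseChange_of_hasGoodReductionAt`, and the Dickson congruence
  `dvd_dickson_one_eval_sub_pow` of gen 0; gen 0 had the direction "up" over `ℚ` only.)
* `goodOrd_of_typeGOrd_of_hasGoodReductionAtPrime` — `p` odd, `TypeGOrd W p`, `Wd` a globally
  minimal model of `E^{(p*)}` with good reduction at `p` ⟹ `GoodOrd Wd p`. Proof: (G)-ordinary
  gives a subfield `F` of a `p`-th cyclotomic field `L` with `E_F` good ordinary at a place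
  `w ∣ p`; go UP to a place `𝔓 ∣ w` of `L` (good reduction and unit root ascend); over `L ∋ √p*`
  (quadratic Gauss sum, `exists_sq_eq_pStar`) `E_L ≅ E^{(p*)}_L`, so `E^{(p*)}_L` is good ordinary
  at `𝔓`; since `E^{(p*)}` is already GOOD at `p` over `ℚ`, the unit-root condition DESCENDS along
  `ℚ ⊆ L` by the first theorem.
* `goodOrd_twist_pStar_of_typeGOrd` — `p ≥ 5`, `TypeGOrd W p`, `e = 2` (`semistabilityIndex W p = 2`,
  Kodaira `I₀*`): EVERY globally minimal model of `E^{(p*)}` is good ORDINARY at `p` (good by gen 3's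
  `hasGoodReductionAtPrime_twist_pStar`, `ord_p j ≥ 0` by `padicValRat_j_nonneg_of_typeGOrd`).
* `typeGOrd_iff_goodOrd_twist_pStar` — on the defect-2 cell at `p ≥ 5`:
  **`TypeGOrd W p ↔ GoodOrd Wd p`** for any globally minimal `Wd ≅ E^{(p*)}`;
  `classX4Gord_iff_goodOrd_twist_pStar`, `classX3Gord_iff_goodOrd_twist_pStar`.
* `exists_goodOrd_twist_pStar_of_typeGOrd` — the datum of the descent files, PRODUCED from the
  theory class: a globally minimal `Wd` with `C • W^{(p*)} = Wd` and `GoodOrd Wd p`.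

So for `(E,p) ∈ X4♯(G-ord) ∩ I₀*`, `p ≥ 5`, the hypothesis `hord` of `bsdp_of_classX4_of_goodOrd_twist`
(etc.) is a THEOREM; the model-free class theorems built on this are in the sibling file
`GordDescentModelFree.lean`. Nothing here changes a label or books a pair.

References: D. Delbourgo, Compositio Math. 113 (1998) §1.5 (G); J. H. Silverman, *AEC* V.2.3.1,
VII.5.4, X.2; R. Greenberg, LNM 1716 (1999) Thm. 1.2 (unit-root hypothesis);
K. Ireland, M. Rosen, GTM 84, Prop. 6.3.2 (Gauss sum).
-/

noncomputable section

open scoped Classical NumberField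

open Polynomial WeierstrassCurve IsDedekindDomain IsDedekindDomain.HeightOneSpectrum NumberField
  Rat.HeightOneSpectrum Literature.NumberTheory.EllipticCurves
  Literature.NumberTheory.EllipticCurves.Rank1Residual

namespace Summit.BirchSwinnertonDyer.Rank1Residual.Additive

universe u

/-! ### The unit-root condition under base change: an equivalence at good reduction -/

section UnitRoot

/-- **Ordinary ⟺ ordinary above, at a place of good reduction** (any finite extension, any
ramification). Let `V/K` be an elliptic curve over a number field with good reduction at the place
`v ∋ p`, `M/K` finite, `w ∣ v`. Then `V_M` satisfies the unit-root condition at `w`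
(`p ∤ a_w`) iff `V` does at `v` (`p ∤ a_v`): `a_w = D_f(a_v, q_v)` (Silverman *AEC* V.2.3.1,
`localPolynomialAt_baseChange_of_hasGoodReductionAt`) and `D_f(t, δ) ≡ t^f (mod δ)` with
`p ∣ δ = q_v` (`dvd_dickson_one_eval_sub_pow`). -/
theorem hasUnitRootAt_baseChange_iff_of_hasGoodReductionAt
    {K : Type u} [Field K] [NumberField K] (V : WeierstrassCurve K) [V.IsElliptic]
    (M : Type u) [Field M] [NumberField M] [Algebra K M] [FiniteDimensional K M]
    (p : ℕ) [hp : Fact p.Prime] {v : HeightOneSpectrum (𝓞 K)} {w : HeightOneSpectrum (𝓞 M)}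
    (hpv : (p : 𝓞 K) ∈ v.asIdeal) (hw : w.asIdeal.under (𝓞 K) = v.asIdeal)
    (hgood : V.HasGoodReductionAt v) :
    (V.baseChange M).HasUnitRootAt w ↔ V.HasUnitRootAt v := by
  -- residue characteristics
  have hpw : (p : 𝓞 M) ∈ w.asIdeal := by
    have : (p : 𝓞 K) ∈ w.asIdeal.under (𝓞 K) := by rw [hw]; exact hpv
    rw [Ideal.under_def, Ideal.mem_comap, map_natCast] at this
    exact this
  have hcv : ringChar (IsLocalRing.ResidueField (v.adicCompletionIntegers K)) = p :=
    ringChar_residueField_eq v hp.out hpv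
  have hcw : ringChar (IsLocalRing.ResidueField (w.adicCompletionIntegers M)) = p :=
    ringChar_residueField_eq w hp.out hpw
  have hqv : (p : ℤ) ∣ (Nat.card (IsLocalRing.ResidueField (v.adicCompletionIntegers K)) : ℤ) := by
    rw [← hcv]
    exact Int.natCast_dvd_natCast.mpr (ringChar_residueField_dvd_natCard v)
  -- the local polynomial upstairs
  haveI : w.asIdeal.LiesOver v.asIdeal := ⟨hw.symm⟩
  have hgoodw : (V.baseChange M).HasGoodReductionAt w :=
    hasGoodReductionAt_baseChange_of_hasGoodReductionAt V M v w hgood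
  have hup := V.localPolynomialAt_baseChange_of_hasGoodReductionAt M hw hgood
    (localPolynomialAt_of_hasGoodReductionAt hgood)
  rw [localPolynomialAt_of_hasGoodReductionAt hgoodw] at hup
  have haw := eq_of_one_sub_C_mul_X_add_eq hup
  -- `f ≥ 1`
  have hf : 0 < w.asIdeal.inertiaDeg (𝓞 K) := by
    haveI : w.asIdeal.IsMaximal := w.isMaximal
    exact Ideal.inertiaDeg_pos w.asIdeal (𝓞 K)
  obtain ⟨f, hf'⟩ : ∃ f, w.asIdeal.inertiaDeg (𝓞 K) = f + 1 :=
    ⟨_, (Nat.succ_pred_eq_of_pos hf).symm⟩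
  -- conclude: `p ∣ a_w ↔ p ∣ a_v`
  rw [hasUnitRootAt_iff_not_dvd_frobeniusTraceAt, hcw, haw, hf',
    hasUnitRootAt_iff_not_dvd_frobeniusTraceAt, hcv, not_iff_not]
  have hD := dvd_dickson_one_eval_sub_pow (V.frobeniusTraceAt v)
    (Nat.card (IsLocalRing.ResidueField (v.adicCompletionIntegers K)) : ℤ) f
  constructor
  · intro hdvd
    have hpow : (p : ℤ) ∣ V.frobeniusTraceAt v ^ (f + 1) := by
      have := dvd_sub hdvd (dvd_trans hqv hD)
      simpa using this
    exact Int.Prime.dvd_pow' hp.out hpow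
  · intro hdvd
    have hpow : (p : ℤ) ∣ V.frobeniusTraceAt v ^ (f + 1) := dvd_pow hdvd (by omega)
    have := dvd_add (dvd_trans hqv hD) hpow
    simpa using this

end UnitRoot

/-! ### (G)-ordinary ⟹ the good twist `E^{(p*)}` is ORDINARY -/

section Twist

variable (W : WeierstrassCurve ℚ) [W.IsElliptic] (p : ℕ) [hp : Fact p.Prime]

/-- **(G)-ORDINARY ⟹ good ordinary twist** (`p` odd). If `E` is of Delbourgo type (G) with
ORDINARY reduction (`TypeGOrd W p`: `E_F` good with the unit-root condition above `p` for a subfield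
`F` of a `p`-th cyclotomic field `L`) and a globally minimal model `Wd` of the quadratic twist
`E^{(p*)}`, `p* = (−1)^{⌊p/2⌋} p`, has GOOD reduction at `p`, then `Wd` is good ORDINARY at `p`
(`GoodOrd Wd p`, i.e. `p ∤ a_p(E^{(p*)})`). Up from `F` to a place `𝔓` of `L`, across the
`L`-isomorphism `E_L ≅ E^{(p*)}_L` (`√p* ∈ L`, `exists_sq_eq_pStar`), and down from `𝔓` to `p` by
`hasUnitRootAt_baseChange_iff_of_hasGoodReductionAt`. -/
theorem goodOrd_of_typeGOrd_of_hasGoodReductionAtPrime (hp2 : p ≠ 2) (hG : TypeGOrd W p)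
    (Wd : WeierstrassCurve ℚ) [Wd.IsElliptic] [Wd.IsGloballyMinimal]
    (hWd : ∃ C : VariableChange ℚ, C • W.quadraticTwist ((-1 : ℚ) ^ (p / 2) * p) = Wd)
    (hgood : Wd.HasGoodReductionAtPrime p) : GoodOrd Wd p := by
  obtain ⟨L, iF, iN, iC, F, hF⟩ := hG
  obtain ⟨C₀, hC₀⟩ := hWd
  haveI : NumberField F := NumberField.of_module_finite ℚ F
  -- a place `w` of `F` above `p`, and a place `𝔓` of `L` above `w`
  obtain ⟨w, hw⟩ := exists_heightOneSpectrum_natCast_mem F p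
  obtain ⟨hgWF, huWF⟩ := hF w hw
  haveI := w.isMaximal
  obtain ⟨Q, hQmax, hQover⟩ :=
    Ideal.exists_maximal_ideal_liesOver_of_isIntegral (S := 𝓞 L) w.asIdeal
  set 𝔓 : HeightOneSpectrum (𝓞 L) :=
    ⟨Q, hQmax.isPrime, Ideal.ne_bot_of_liesOver_of_ne_bot w.ne_bot Q⟩ with h𝔓def
  haveI h𝔓w' : 𝔓.asIdeal.LiesOver w.asIdeal := hQover
  have h𝔓w : 𝔓.asIdeal.under (𝓞 F) = w.asIdeal := hQover.over.symm
  have hp𝔓 : (p : 𝓞 L) ∈ 𝔓.asIdeal := by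
    have : (p : 𝓞 F) ∈ 𝔓.asIdeal.under (𝓞 F) := by rw [h𝔓w]; exact hw
    rw [Ideal.under_def, Ideal.mem_comap, map_natCast] at this
    exact this
  -- the place `v` of `ℚ` over `p`
  set v : HeightOneSpectrum (𝓞 ℚ) := (primesEquiv (R := 𝓞 ℚ)).symm ⟨p, hp.out⟩ with hvdef
  have hpv : (p : 𝓞 ℚ) ∈ v.asIdeal :=
    (natCast_mem_asIdeal_iff_eq_primesEquiv_symm v hp.out).mpr rfl
  have h𝔓v : 𝔓.asIdeal.under (𝓞 ℚ) = v.asIdeal := under_eq_asIdeal_of_natCast_mem p 𝔓 hp𝔓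
  -- `E_L` good with unit root at `𝔓` (up from `F`)
  haveI : (W.baseChange F).IsElliptic := by rw [baseChange]; infer_instance
  have hWL : (W.baseChange F).baseChange L = W.baseChange L := by
    rw [baseChange, show algebraMap F L = (IsScalarTower.toAlgHom ℚ F L : F →+* L) from rfl]
    exact W.map_baseChange (IsScalarTower.toAlgHom ℚ F L)
  have hgWL : (W.baseChange L).HasGoodReductionAt 𝔓 := by
    rw [← hWL]
    exact hasGoodReductionAt_baseChange_of_hasGoodReductionAt (W.baseChange F) L w 𝔓 hgWF
  have huWL : (W.baseChange L).HasUnitRootAt 𝔓 := by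
    rw [← hWL]
    exact (hasUnitRootAt_baseChange_iff_of_hasGoodReductionAt (W.baseChange F) L p hw h𝔓w
      hgWF).mpr huWF
  -- `W_L ≅ Wd_L`: over `L` the twist parameter `p*` is a square
  set d : ℚ := (-1 : ℚ) ^ (p / 2) * p with hd
  obtain ⟨g, hg⟩ := exists_sq_eq_pStar p L hp2
  have hg2 : (algebraMap ℚ L) d = 1 * g ^ 2 := by
    rw [one_mul, hg, hd, map_mul, map_pow, map_neg, map_one, map_natCast]
  have hg0 : g ≠ 0 := by
    intro h0
    have : (algebraMap ℚ L) d = 0 := by rw [hg2, h0]; simp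
    rw [map_eq_zero] at this
    exact (mul_ne_zero (pow_ne_zero _ (by norm_num)) (by exact_mod_cast hp.out.ne_zero)) this
  have htw : (W.quadraticTwist d).baseChange L = (W.baseChange L).quadraticTwist (1 * g ^ 2) := by
    rw [← hg2]
    exact map_quadraticTwist W (algebraMap ℚ L) d
  haveI : NeZero (2 : L) := ⟨two_ne_zero⟩
  haveI : (W.baseChange L).IsElliptic := by rw [baseChange]; infer_instance
  obtain ⟨C₁, hC₁⟩ := exists_variableChange_quadraticTwist_one (W.baseChange L)
  obtain ⟨C₂, hC₂⟩ := exists_variableChange_quadraticTwist_mul_sq (W.baseChange L) 1 g hg0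
  have hWdL : Wd.baseChange L = (C₀.map (algebraMap ℚ L)) • (W.quadraticTwist d).baseChange L := by
    rw [← hC₀, baseChange, baseChange, ← map_variableChange]
  have hiso : (C₀.map (algebraMap ℚ L) * (C₂ * C₁)) • W.baseChange L = Wd.baseChange L := by
    rw [mul_smul, mul_smul, hC₁, hC₂, ← htw, hWdL]
  -- transport to `Wd_L` at `𝔓`
  have hgDL : (Wd.baseChange L).HasGoodReductionAt 𝔓 := by
    rw [← hiso]
    exact (hasGoodReductionAt_smul_iff_holds 𝔓 (W.baseChange L)
      (C₀.map (algebraMap ℚ L) * (C₂ * C₁))).mpr hgWL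
  have huDL : (Wd.baseChange L).HasUnitRootAt 𝔓 := by
    rw [← hiso]
    exact (hasUnitRootAt_smul_iff (W.baseChange L) (C₀.map (algebraMap ℚ L) * (C₂ * C₁)) 𝔓
      hgWL).mpr huWL
  -- down to `ℚ`: `Wd` is good at `p`, so ordinarity descends
  have hgDv : Wd.HasGoodReductionAt v := hasGoodReductionAt_of_hasGoodReductionAtPrime p Wd hgood
  have huDv : Wd.HasUnitRootAt v :=
    (hasUnitRootAt_baseChange_iff_of_hasGoodReductionAt Wd L p hpv h𝔓v hgDv).mp huDL
  exact ⟨hgood, (Wd.hasUnitRootAt_iff_not_dvd_frobeniusTrace v hp.out hpv).mp huDv⟩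

variable [W.IsGloballyMinimal]

/-- **(G)-ORDINARY on the defect-2 cell ⟹ every globally minimal model of `E^{(p*)}` is good
ORDINARY at `p`** (`p ≥ 5`, `e = semistabilityIndex W p = 2`, i.e. Kodaira `I₀*`): good by gen 3's
`hasGoodReductionAtPrime_twist_pStar` (`ord_p j ≥ 0` from `padicValRat_j_nonneg_of_typeGOrd`,
`ord_p Δ_min ≡ 6 (mod 12)` from `semistabilityIndex_eq_two_iff`), ordinary by
`goodOrd_of_typeGOrd_of_hasGoodReductionAtPrime`. The twist datum `hord : GoodOrd Wd p` of the
descent theorems (`GordDescent.lean` …) is therefore a consequence of the theory class. -/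
theorem goodOrd_twist_pStar_of_typeGOrd (hp5 : 5 ≤ p) (hG : TypeGOrd W p)
    (he : semistabilityIndex W p = 2) (Wd : WeierstrassCurve ℚ) [Wd.IsElliptic]
    [Wd.IsGloballyMinimal]
    (hWd : ∃ C : VariableChange ℚ, C • W.quadraticTwist ((-1 : ℚ) ^ (p / 2) * p) = Wd) :
    GoodOrd Wd p := by
  have hp2 : p ≠ 2 := by omega
  obtain ⟨C, hC⟩ := hWd
  have hgood : Wd.HasGoodReductionAtPrime p :=
    hasGoodReductionAtPrime_twist_pStar W p hp5 (padicValRat_j_nonneg_of_typeGOrd W p hG)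
      ((semistabilityIndex_eq_two_iff W p).mp he) Wd C hC
  exact goodOrd_of_typeGOrd_of_hasGoodReductionAtPrime W p hp2 hG Wd ⟨C, hC⟩ hgood

/-- **The defect-2 dictionary is an EQUIVALENCE** (`p ≥ 5`, `e = 2`): for any globally minimal model
`Wd` of `E^{(p*)}`, `TypeGOrd W p ↔ GoodOrd Wd p` (⇐ is gen 0's `typeGOrd_of_goodOrd_quadraticTwist`). -/
theorem typeGOrd_iff_goodOrd_twist_pStar (hp5 : 5 ≤ p) (he : semistabilityIndex W p = 2)
    (Wd : WeierstrassCurve ℚ) [Wd.IsElliptic] [Wd.IsGloballyMinimal] (C : VariableChange ℚ)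
    (hWd : C • W.quadraticTwist ((-1 : ℚ) ^ (p / 2) * p) = Wd) :
    TypeGOrd W p ↔ GoodOrd Wd p :=
  ⟨fun hG ↦ goodOrd_twist_pStar_of_typeGOrd W p hp5 hG he Wd ⟨C, hWd⟩,
    fun hord ↦ typeGOrd_of_goodOrd_quadraticTwist W p (by omega) Wd C hWd hord⟩

/-- **X4♯(G-ord) ∩ I₀* decided on the twist** (`p ≥ 5`, `e = 2`): `ClassX4Gord W p ↔
ClassX4 W p ∧ GoodOrd Wd p` for any globally minimal `Wd ≅ E^{(p*)}` — the census bit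
"`p ∤ a_p(E^{(p*)})`" IS the theory class on this cell. -/
theorem classX4Gord_iff_goodOrd_twist_pStar (hp5 : 5 ≤ p) (he : semistabilityIndex W p = 2)
    (Wd : WeierstrassCurve ℚ) [Wd.IsElliptic] [Wd.IsGloballyMinimal] (C : VariableChange ℚ)
    (hWd : C • W.quadraticTwist ((-1 : ℚ) ^ (p / 2) * p) = Wd) :
    ClassX4Gord W p ↔ ClassX4 W p ∧ GoodOrd Wd p := by
  unfold ClassX4Gord
  rw [typeGOrd_iff_goodOrd_twist_pStar W p hp5 he Wd C hWd]

/-- **X3♯(G-ord) ∩ I₀* decided on the twist** (`p ≥ 5`, `e = 2`): `ClassX3Gord W p ↔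
ClassX3 W p ∧ GoodOrd Wd p` (for X3 the right conjunct is moreover automatic from `ClassX3 ∧ SubGordTwo`,
gen 3's `classX3Gord_of_subGordTwo`). -/
theorem classX3Gord_iff_goodOrd_twist_pStar (hp5 : 5 ≤ p) (he : semistabilityIndex W p = 2)
    (Wd : WeierstrassCurve ℚ) [Wd.IsElliptic] [Wd.IsGloballyMinimal] (C : VariableChange ℚ)
    (hWd : C • W.quadraticTwist ((-1 : ℚ) ^ (p / 2) * p) = Wd) :
    ClassX3Gord W p ↔ ClassX3 W p ∧ GoodOrd Wd p := by
  unfold ClassX3Gord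
  rw [typeGOrd_iff_goodOrd_twist_pStar W p hp5 he Wd C hWd]

/-- **The twist datum of the descent files, PRODUCED from the theory class** (`p ≥ 5`, `e = 2`):
for `TypeGOrd W p` there is a globally minimal model `Wd` of `E^{(p*)}` (Néron,
`hasGlobalMinimalModel_rat_holds`) with `GoodOrd Wd p`. -/
theorem exists_goodOrd_twist_pStar_of_typeGOrd (hp5 : 5 ≤ p) (hG : TypeGOrd W p)
    (he : semistabilityIndex W p = 2) :
    ∃ (Wd : WeierstrassCurve ℚ) (_ : Wd.IsElliptic) (_ : Wd.IsGloballyMinimal)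
      (C : VariableChange ℚ), C • W.quadraticTwist ((-1 : ℚ) ^ (p / 2) * p) = Wd ∧
        GoodOrd Wd p := by
  set d : ℚ := (-1 : ℚ) ^ (p / 2) * p with hddef
  have hd0 : d ≠ 0 :=
    mul_ne_zero (pow_ne_zero _ (by norm_num)) (by exact_mod_cast hp.out.ne_zero)
  haveI : NeZero (2 : ℚ) := ⟨two_ne_zero⟩
  haveI : (W.quadraticTwist d).IsElliptic := W.isElliptic_quadraticTwist hd0
  obtain ⟨C, hC⟩ := hasGlobalMinimalModel_rat_holds (W.quadraticTwist d)
  haveI := hC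
  exact ⟨C • W.quadraticTwist d, inferInstance, hC, C, rfl,
    goodOrd_twist_pStar_of_typeGOrd W p hp5 hG he (C • W.quadraticTwist d) ⟨C, rfl⟩⟩

end Twist

end Summit.BirchSwinnertonDyer.Rank1Residual.Additive

end
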